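/-
Copyright (c) 2026 the pub-hodgecm-mathlib formalisation cell (harness21).  Prover seat hodgecm-mathlib-A-p06 (g28) — (U) road, U2 FILE F «μ^TF = ⊗_w μ^TF_w», 2026-09-01.
-/
import Literature.NumberTheory.Weil1964.UnitaryArchSkewPlaces              -- FILE D (A-p06 g28): `skewPiEquiv`, `conj_skewMulL`
import Literature.NumberTheory.Weil1964.UnitaryArchTopFormHaarWindowAny     -- ★ (P0) `archTopFormHaar_restrict_image_of_isOpen`
import Literature.NumberTheory.Automorphic.UnitaryFormGroupUnimodular       -- ★ `locallyCompactSpace_unitaryGroupOfForm_complex`, `secondCountableTopology_…`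
import Mathlib.MeasureTheory.Integral.Pi
import HarnessLib

/-!
# The top-form Haar measure of `U(J)(E ⊗ ℝ) = Π_w U(σ_w J)(ℂ)` is the product of the one-place top-form Haar measures ((U) road, U2 FILE F)

Topic `NumberTheory/Weil1964`, namespace `Literature.NumberTheory.Weil1964.UnitaryArchTopForm`.  THEOREMS ONLY (no definition, no instance, no notation, no named fact,
no `sorry`).  Cell `pub/hodgecm-mathlib`, crux H413 = `stmt-HodgeConjecture-24833` (supports only); (U) road U2 (LEAD T9-34 (2) ∕ T9-36; owner A-p19 (g24)).

`μ^TF = archTopFormHaar F E c N J` (★ `UnitaryArchTopFormHaar`: the Haar measure of `U(J)(E ⊗ ℝ)` pinned on the Cayley window by the top-form chart measure) is carried by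
★ `archPiEquiv : U(J)(E ⊗ ℝ) ≃ₜ* Π_w U(σ_w J)(ℂ)` to the product `⊗_w μ^TF_w` of the one-place top-form Haar measures (★ FILE B `localTopFormHaar`).  Proof: both sides are
Haar measures on the product group (Mathlib `Measure.pi.isHaarMeasure`, `ContinuousMulEquiv.isHaarMeasure_map`), hence proportional (`isMulLeftInvariant_eq_smul`); the
constant is `1` because they agree on the product of the one-place Cayley windows: the `μ^TF`-side is the chart measure of the PRODUCT window (★ (P0)
`archTopFormHaar_restrict_image_of_isOpen` — the window of record is not needed), which factorises by Fubini once (E1) `λ ↦ ⊗_w λ_w` under `skewPiEquiv` and (E2)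
`w₀ = Π_w w₀,w` are known — taken here as the hypotheses `hlam`, `hweight` of the `_of` form (U2 FILE E discharges them).
HONEST LABEL: HC_CM is proved only modulo the 2 remaining named inputs (hLiu418 24832, h413 24833) until rung 0 closes; nothing printed is discharged here.

## References
* J. D. Rogawski, *Automorphic Representations of Unitary Groups in Three Variables*, Ann. of Math. Stud. 123 (1990), §1.7 p. 6 («`dg = Π_v dg_v`, `dg_v = |Ω|_v`»). [Rogawski1990]
* S. Helgason, *Groups and Geometric Analysis* (2000), Ch. I §1 Thm. 1.14 p. 96. [Helgason2000]
-/

set_option autoImplicit false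
-- submodule-normed vs subtype topologies on `↥(skewC …)` ∕ `↥(archSkew …)` (as in ★ FILE B ∕ ★ `UnitaryArchTopFormHaar`)
set_option backward.isDefEq.respectTransparency false

noncomputable section

open Set MeasureTheory MeasureTheory.Measure NumberField NumberField.InfinitePlace NumberField.mixedEmbedding Literature.Analysis.Calculus
open scoped Classical Matrix Matrix.Norms.Operator MatrixGroups ENNReal NNReal

namespace Literature.NumberTheory.Weil1964

namespace UnitaryArchTopForm

open Literature.NumberTheory.Automorphic Literature.NumberTheory.Automorphic.UnitaryGroup Literature.NumberTheory.Weil1964.UnitaryArchLocalTopForm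

section Places

variable (F E : Type) [Field F] [Field E] [NumberField E] [Algebra F E] (c : E ≃ₐ[F] E) (N : ℕ) (J : Matrix (Fin N) (Fin N) E)

variable {F E c N J}

/-! ## §1 Units, the Cayley source and the Cayley chart, place by place -/

/-- A ring homomorphism commutes with the Cayley transform at points where `1 + X` is invertible. [cite: Weyl1939, Ch. II §10] -/
theorem map_cayley_of_isUnit {R S : Type} [Ring R] [Ring S] (φ : R →+* S) {X : R} (h : IsUnit (1 + X)) : φ (cayley X) = cayley (φ X) := by
  obtain ⟨u, hu⟩ := h
  have hu' : (1 : S) + φ X = ↑(Units.map (φ : R →* S) u) := by rw [Units.coe_map, MonoidHom.coe_coe, hu, map_add, map_one]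
  rw [cayley_def, cayley_def, map_mul, map_sub, map_one, ← hu, hu', Ring.inverse_unit, Ring.inverse_unit, Units.coe_map_inv,
    MonoidHom.coe_coe]

omit [NumberField E] in
/-- A matrix over `E ⊗ ℝ = ℂ^{r₂}` is invertible iff all its complex coordinates are (CM situation: no real place). [cite: Knapp2002, I §1] -/
theorem isUnit_iff_forall_isUnit_map_evalC (hc : c ≠ 1) (hfix : ∀ w : InfinitePlace E, c • w = w) (A : Matrix (Fin N) (Fin N) (mixedSpace E)) :
    IsUnit A ↔ ∀ w : {w : InfinitePlace E // IsComplex w}, IsUnit (A.map (evalC E w)) := by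
  refine ⟨fun h w => (h.map (evalC E w).mapMatrix), fun h => ?_⟩
  haveI := UnitaryArchTopForm.isEmpty_isReal (F := F) (E := E) hc hfix
  rw [Matrix.isUnit_iff_isUnit_det, Prod.isUnit_iff, Pi.isUnit_iff, Pi.isUnit_iff]
  refine ⟨fun v => isEmptyElim v, fun w => ?_⟩
  have h1 : (A.det).2 w = (A.map (evalC E w)).det := by rw [← evalC_apply E w A.det, RingHom.map_det, RingHom.mapMatrix_apply]
  rw [h1, ← Matrix.isUnit_iff_isUnit_det]
  exact h w

omit [NumberField E] in
/-- **The Cayley source place by place**: `X ∈ cayleySource ↔ ∀ w, X_w ∈ cayleySourceC`. [cite: Weyl1939, Ch. II §10] -/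
theorem mem_cayleySource_iff_forall (hc : c ≠ 1) (hfix : ∀ w : InfinitePlace E, c • w = w) (X : archSkew F E c N J) :
    X ∈ cayleySource F E c N J ↔ ∀ w : {w : InfinitePlace E // IsComplex w}, skewPiEquiv F E c N J hc hfix X w ∈ cayleySourceC N (J.map w.1.embedding) := by
  have h1 : ∀ w : {w : InfinitePlace E // IsComplex w},
      (1 + (X : Matrix (Fin N) (Fin N) (mixedSpace E))).map (evalC E w) = 1 + (X : Matrix (Fin N) (Fin N) (mixedSpace E)).map (evalC E w) := fun w => by
    rw [← RingHom.mapMatrix_apply, map_add, map_one, RingHom.mapMatrix_apply]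
  have h2 : ∀ w : {w : InfinitePlace E // IsComplex w},
      (1 - (X : Matrix (Fin N) (Fin N) (mixedSpace E))).map (evalC E w) = 1 - (X : Matrix (Fin N) (Fin N) (mixedSpace E)).map (evalC E w) := fun w => by
    rw [← RingHom.mapMatrix_apply, map_sub, map_one, RingHom.mapMatrix_apply]
  simp only [mem_cayleySource_iff, mem_cayleySourceC_iff, coe_skewPiEquiv_apply, isUnit_iff_forall_isUnit_map_evalC (F := F) (c := c) hc hfix, h1, h2]
  exact ⟨fun h w => ⟨h.1 w, h.2 w⟩, fun h => ⟨fun w => (h w).1, fun w => (h w).2⟩⟩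

omit [NumberField E] in
/-- **The Cayley chart place by place**: `(ĉ X)_w = ĉ_w(X_w)` on the source. [cite: Weyl1939, Ch. II §10] [cite: Rogawski1990, §1.7 p. 6] -/
theorem archPiEquiv_cayleyChart (hc : c ≠ 1) (hfix : ∀ w : InfinitePlace E, c • w = w) {X : archSkew F E c N J} (hX : X ∈ cayleySource F E c N J)
    (w : {w : InfinitePlace E // IsComplex w}) :
    archPiEquiv F E c N J hc hfix (cayleyChart F E c N J X) w = cayleyChartC N (J.map w.1.embedding) (skewPiEquiv F E c N J hc hfix X w) := by
  have hXw := (mem_cayleySource_iff_forall hc hfix X).1 hX w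
  have key : ((((archPiEquiv F E c N J hc hfix (cayleyChart F E c N J X) w : archLocal E N J w) : GL (Fin N) ℂ) : Matrix (Fin N) (Fin N) ℂ)) =
      cayley (((X : Matrix (Fin N) (Fin N) (mixedSpace E))).map (evalC E w)) := by
    rw [archPiEquiv_apply, coe_archAt]
    change (evalC E w).mapMatrix (((cayleyChart F E c N J X : GL (Fin N) (mixedSpace E)) : Matrix (Fin N) (Fin N) (mixedSpace E))) = _
    rw [coe_cayleyChart J hX, map_cayley_of_isUnit _ hX.1, RingHom.mapMatrix_apply]
  apply Subtype.ext
  apply Units.ext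
  rw [key, coe_cayleyChartC hXw, coe_skewPiEquiv_apply]

omit [NumberField E] in
/-- The product of one-place chart images is the chart image of the product set, read through `archPiEquiv` ∕ `skewPiEquiv`. [cite: Rogawski1990, §1.7 p. 6] -/
theorem archPiEquiv_preimage_pi_image_cayleyChartC (hc : c ≠ 1) (hfix : ∀ w : InfinitePlace E, c • w = w)
    (W : ∀ w : {w : InfinitePlace E // IsComplex w}, Set (skewC N (J.map w.1.embedding)))
    (hW : ∀ w, W w ⊆ cayleySourceC N (J.map w.1.embedding)) :
    archPiEquiv F E c N J hc hfix ⁻¹' Set.pi Set.univ (fun w => cayleyChartC N (J.map w.1.embedding) '' W w) =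
      cayleyChart F E c N J '' (skewPiEquiv F E c N J hc hfix ⁻¹' Set.pi Set.univ W) := by
  ext g
  simp only [mem_preimage, mem_univ_pi, mem_image]
  constructor
  · intro h
    choose Y hYW hYg using h
    have hX : (skewPiEquiv F E c N J hc hfix).symm Y ∈ cayleySource F E c N J :=
      (mem_cayleySource_iff_forall hc hfix _).2 fun w => by rw [ContinuousLinearEquiv.apply_symm_apply]; exact hW w (hYW w)
    refine ⟨(skewPiEquiv F E c N J hc hfix).symm Y, fun w => by rw [ContinuousLinearEquiv.apply_symm_apply]; exact hYW w, ?_⟩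
    apply (archPiEquiv F E c N J hc hfix).injective
    funext w
    rw [archPiEquiv_cayleyChart hc hfix hX, ContinuousLinearEquiv.apply_symm_apply, hYg]
  · rintro ⟨X, hXW, rfl⟩ w
    have hX : X ∈ cayleySource F E c N J := (mem_cayleySource_iff_forall hc hfix X).2 fun w => hW w (hXW w)
    exact ⟨_, hXW w, (archPiEquiv_cayleyChart hc hfix hX w).symm⟩

/-! ## §2 Fubini for the weights: a product of non-negative integrable densities -/

/-- `∫⁻ Π_w ofReal (f_w (y_w)) d(⊗_w μ_w) = Π_w ∫⁻ ofReal (f_w) dμ_w` for integrable non-negative `f_w` (Bochner Fubini `integral_fintype_prod_eq_prod` read in `ℝ≥0∞`).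
[cite: Helgason2000, Ch. I §1 Thm. 1.14 p. 96] -/
theorem lintegral_pi_prod_ofReal {ι : Type} [Fintype ι] {α : ι → Type} [∀ i, MeasurableSpace (α i)] (μ : ∀ i, Measure (α i)) [∀ i, SigmaFinite (μ i)]
    {f : ∀ i, α i → ℝ} (hf : ∀ i, Integrable (f i) (μ i)) (hnn : ∀ i x, 0 ≤ f i x) :
    ∫⁻ y, ∏ i, ENNReal.ofReal (f i (y i)) ∂Measure.pi μ = ∏ i, ∫⁻ x, ENNReal.ofReal (f i x) ∂μ i := by
  have h1 : (fun y : ∀ i, α i => ∏ i, ENNReal.ofReal (f i (y i))) = fun y => ENNReal.ofReal (∏ i, f i (y i)) :=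
    funext fun y => (ENNReal.ofReal_prod_of_nonneg fun i _ => hnn i (y i)).symm
  rw [h1, ← ofReal_integral_eq_lintegral_ofReal (Integrable.fintype_prod_dep hf) (Filter.Eventually.of_forall fun y => Finset.prod_nonneg fun i _ => hnn i (y i)),
    integral_fintype_prod_eq_prod, ENNReal.ofReal_prod_of_nonneg fun i _ => integral_nonneg (hnn i)]
  exact Finset.prod_congr rfl fun i _ => ofReal_integral_eq_lintegral_ofReal (hf i) (Filter.Eventually.of_forall (hnn i))

/-- The one-place weight is non-negative. [cite: Helgason2000, Ch. I §1 Thm. 1.14 p. 96] -/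
theorem cayleyWeightC_nonneg {Jw : Matrix (Fin N) (Fin N) ℂ} (Y : skewC N Jw) : 0 ≤ cayleyWeightC N Jw Y := by
  rw [cayleyWeightC_def]; exact inv_nonneg.2 (abs_nonneg _)

end Places

/-! ## §3 The product theorem -/

section ProductMeasure

variable (F E : Type) [Field F] [Field E] [NumberField E] [Algebra F E] (c : E ≃ₐ[F] E) (N : ℕ) (J : Matrix (Fin N) (Fin N) E)

variable {F E c N J}

variable [MeasurableSpace (archSkew F E c N J)] [BorelSpace (archSkew F E c N J)] [MeasurableSpace (arch F E c N J)] [BorelSpace (arch F E c N J)]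
  [MeasurableSpace (GL (Fin N) ℂ)] [BorelSpace (GL (Fin N) ℂ)]
  [∀ w : {w : InfinitePlace E // IsComplex w}, MeasurableSpace ↥(skewC N (J.map w.1.embedding))]
  [∀ w : {w : InfinitePlace E // IsComplex w}, BorelSpace ↥(skewC N (J.map w.1.embedding))]

omit [NumberField E] [MeasurableSpace ↥(archSkew F E c N J)] [BorelSpace ↥(archSkew F E c N J)] [MeasurableSpace ↥(arch F E c N J)]
  [BorelSpace ↥(arch F E c N J)] [MeasurableSpace (GL (Fin N) ℂ)] [BorelSpace (GL (Fin N) ℂ)] in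
/-- The one-place weight `w₀,w` is integrable on the one-place window against any measure finite on compacts. [cite: Helgason2000, Ch. I §1 Thm. 1.14 p. 96] -/
theorem integrableOn_cayleyWeightC_windowC (w : {w : InfinitePlace E // IsComplex w}) (lam : Measure ↥(skewC N (J.map w.1.embedding)))
    [IsFiniteMeasureOnCompacts lam] :
    IntegrableOn (cayleyWeightC N (J.map w.1.embedding)) (windowC N (J.map w.1.embedding)) lam :=
  ((continuousOn_cayleyWeightC.mono closedBall_windowRadiusC_subset).integrableOn_compact (isCompact_closedBall _ _)).mono_set
    Metric.ball_subset_closedBall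

omit [NumberField E] [MeasurableSpace ↥(archSkew F E c N J)] [BorelSpace ↥(archSkew F E c N J)] [MeasurableSpace ↥(arch F E c N J)]
  [BorelSpace ↥(arch F E c N J)] [∀ w : {w : InfinitePlace E // IsComplex w}, MeasurableSpace ↥(skewC N (J.map w.1.embedding))]
  [∀ w : {w : InfinitePlace E // IsComplex w}, BorelSpace ↥(skewC N (J.map w.1.embedding))] in
/-- `μ^TF_w(ĉ_w(W_w)) = ∫_{W_w} w₀,w dλ_w`, with a `[BorelSpace]` binder instance on `𝔲(Jw)` (★ FILE B states it at `borel`). [cite: Helgason2000, Ch. I §1 Thm. 1.14 p. 96] -/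
theorem localTopFormHaar_image_windowC_eq_lintegral (Jw : Matrix (Fin N) (Fin N) ℂ) [iM : MeasurableSpace ↥(skewC N Jw)] [BorelSpace ↥(skewC N Jw)] :
    localTopFormHaar N Jw (cayleyChartC N Jw '' windowC N Jw) = ∫⁻ X in windowC N Jw, ENNReal.ofReal (cayleyWeightC N Jw X) ∂lieStdLebesgueC N Jw := by
  have h : iM = borel _ := BorelSpace.measurable_eq
  subst h
  letI : MeasurableSpace ↥(skewC N Jw) := borel _
  rw [localTopFormHaar_image_window, ← cayleyChartMeasureC_image_window]

omit [MeasurableSpace ↥(archSkew F E c N J)] [BorelSpace ↥(archSkew F E c N J)] [MeasurableSpace ↥(arch F E c N J)] [BorelSpace ↥(arch F E c N J)] in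
/-- `(⊗_w μ^TF_w)(Π_w ĉ_w(W_w)) = Π_w ∫_{W_w} w₀,w dλ_w`. [cite: Helgason2000, Ch. I §1 Thm. 1.14 p. 96] [cite: Rogawski1990, §1.7 p. 6] -/
theorem pi_localTopFormHaar_pi_image_windowC (hndw : ∀ w : {w : InfinitePlace E // IsComplex w}, lieGramDetC N (J.map w.1.embedding) ≠ 0) :
    (Measure.pi fun w : {w : InfinitePlace E // IsComplex w} => localTopFormHaar N (J.map w.1.embedding))
      (Set.pi Set.univ fun w => cayleyChartC N (J.map w.1.embedding) '' windowC N (J.map w.1.embedding)) =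
      ∏ w : {w : InfinitePlace E // IsComplex w}, ∫⁻ X in windowC N (J.map w.1.embedding),
        ENNReal.ofReal (cayleyWeightC N (J.map w.1.embedding) X) ∂lieStdLebesgueC N (J.map w.1.embedding) := by
  haveI : ∀ w : {w : InfinitePlace E // IsComplex w}, LocallyCompactSpace ↥(unitaryGroupOfForm (starRingEnd ℂ) (J.map w.1.embedding)) := fun w =>
    locallyCompactSpace_unitaryGroupOfForm_complex (n := Fin N) (J.map w.1.embedding)
  haveI : ∀ w : {w : InfinitePlace E // IsComplex w}, SecondCountableTopology ↥(unitaryGroupOfForm (starRingEnd ℂ) (J.map w.1.embedding)) := fun w =>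
    secondCountableTopology_unitaryGroupOfForm_complex (n := Fin N) (J.map w.1.embedding)
  haveI : ∀ w : {w : InfinitePlace E // IsComplex w}, (localTopFormHaar N (J.map w.1.embedding)).IsHaarMeasure := fun w =>
    isHaarMeasure_localTopFormHaar (hndw w)
  rw [Measure.pi_pi]
  exact Finset.prod_congr rfl fun w _ => localTopFormHaar_image_windowC_eq_lintegral (J.map w.1.embedding)

omit [MeasurableSpace ↥(archSkew F E c N J)] [BorelSpace ↥(archSkew F E c N J)] [MeasurableSpace ↥(arch F E c N J)] [BorelSpace ↥(arch F E c N J)]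
  [∀ w : {w : InfinitePlace E // IsComplex w}, MeasurableSpace ↥(skewC N (J.map w.1.embedding))]
  [∀ w : {w : InfinitePlace E // IsComplex w}, BorelSpace ↥(skewC N (J.map w.1.embedding))] in
/-- `0 < (⊗_w μ^TF_w)(Π_w ĉ_w(W_w)) < ∞`. [cite: Helgason2000, Ch. I §1 Thm. 1.14 p. 96] -/
theorem pi_localTopFormHaar_pi_image_windowC_ne (hndw : ∀ w : {w : InfinitePlace E // IsComplex w}, lieGramDetC N (J.map w.1.embedding) ≠ 0) :
    (Measure.pi fun w : {w : InfinitePlace E // IsComplex w} => localTopFormHaar N (J.map w.1.embedding))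
        (Set.pi Set.univ fun w => cayleyChartC N (J.map w.1.embedding) '' windowC N (J.map w.1.embedding)) ≠ 0 ∧
      (Measure.pi fun w : {w : InfinitePlace E // IsComplex w} => localTopFormHaar N (J.map w.1.embedding))
        (Set.pi Set.univ fun w => cayleyChartC N (J.map w.1.embedding) '' windowC N (J.map w.1.embedding)) ≠ ⊤ := by
  haveI : ∀ w : {w : InfinitePlace E // IsComplex w}, LocallyCompactSpace ↥(unitaryGroupOfForm (starRingEnd ℂ) (J.map w.1.embedding)) := fun w =>
    locallyCompactSpace_unitaryGroupOfForm_complex (n := Fin N) (J.map w.1.embedding)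
  haveI : ∀ w : {w : InfinitePlace E // IsComplex w}, SecondCountableTopology ↥(unitaryGroupOfForm (starRingEnd ℂ) (J.map w.1.embedding)) := fun w =>
    secondCountableTopology_unitaryGroupOfForm_complex (n := Fin N) (J.map w.1.embedding)
  haveI : ∀ w : {w : InfinitePlace E // IsComplex w}, (localTopFormHaar N (J.map w.1.embedding)).IsHaarMeasure := fun w =>
    isHaarMeasure_localTopFormHaar (hndw w)
  rw [Measure.pi_pi]
  exact ⟨Finset.prod_ne_zero_iff.2 fun w _ => haar_image_windowC_ne_zero _, ENNReal.prod_ne_top fun w _ => haar_image_windowC_ne_top _⟩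

omit [MeasurableSpace (GL (Fin N) ℂ)] [BorelSpace (GL (Fin N) ℂ)] [∀ w : {w : InfinitePlace E // IsComplex w}, MeasurableSpace ↥(skewC N (J.map w.1.embedding))]
  [∀ w : {w : InfinitePlace E // IsComplex w}, BorelSpace ↥(skewC N (J.map w.1.embedding))] in
/-- **`μ^TF` on the chart image of the product set `V = skewPiEquiv⁻¹(Π_w W_w)`**: `μ^TF(ĉ(V)) = ∫_V w₀ dλ` — ★ (P0) `archTopFormHaar_restrict_image_of_isOpen` on the product
window (open, `∋ 0`, relatively compact inside the product of the closed one-place balls, which lies in the source). [cite: Helgason2000, Ch. I §1 Thm. 1.14 p. 96] -/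
theorem archTopFormHaar_image_preimage_pi_windowC (hc : c ≠ 1) (hfix : ∀ w : InfinitePlace E, c • w = w) (hnd : lieGramDet F E c N J ≠ 0) :
    archTopFormHaar F E c N J (cayleyChart F E c N J ''
        (skewPiEquiv F E c N J hc hfix ⁻¹' Set.pi Set.univ fun w : {w : InfinitePlace E // IsComplex w} => windowC N (J.map w.1.embedding))) =
      ∫⁻ X in skewPiEquiv F E c N J hc hfix ⁻¹' Set.pi Set.univ (fun w : {w : InfinitePlace E // IsComplex w} => windowC N (J.map w.1.embedding)),
        ENNReal.ofReal (cayleyWeight F E c N J X) ∂lieStdLebesgue F E c N J := by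
  have hVo : IsOpen (skewPiEquiv F E c N J hc hfix ⁻¹' Set.pi Set.univ fun w : {w : InfinitePlace E // IsComplex w} => windowC N (J.map w.1.embedding)) :=
    (isOpen_set_pi Set.finite_univ fun w _ => isOpen_windowC).preimage (skewPiEquiv F E c N J hc hfix).continuous
  have hV0 : (0 : archSkew F E c N J) ∈
      skewPiEquiv F E c N J hc hfix ⁻¹' Set.pi Set.univ fun w : {w : InfinitePlace E // IsComplex w} => windowC N (J.map w.1.embedding) := by
    rw [Set.mem_preimage, map_zero]
    exact fun w _ => zero_mem_windowC
  have hK : IsCompact (skewPiEquiv F E c N J hc hfix ⁻¹' Set.pi Set.univ fun w : {w : InfinitePlace E // IsComplex w} =>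
      Metric.closedBall (0 : ↥(skewC N (J.map w.1.embedding))) (windowRadiusC N (J.map w.1.embedding))) := by
    rw [← ContinuousLinearEquiv.image_symm_eq_preimage]
    exact (isCompact_univ_pi fun w => isCompact_closedBall _ _).image (skewPiEquiv F E c N J hc hfix).symm.continuous
  have hKs : (skewPiEquiv F E c N J hc hfix ⁻¹' Set.pi Set.univ fun w : {w : InfinitePlace E // IsComplex w} =>
      Metric.closedBall (0 : ↥(skewC N (J.map w.1.embedding))) (windowRadiusC N (J.map w.1.embedding))) ⊆ cayleySource F E c N J :=
    fun X hX => (mem_cayleySource_iff_forall hc hfix X).2 fun w => closedBall_windowRadiusC_subset (hX w (Set.mem_univ w))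
  have hVK : (skewPiEquiv F E c N J hc hfix ⁻¹' Set.pi Set.univ fun w : {w : InfinitePlace E // IsComplex w} => windowC N (J.map w.1.embedding)) ⊆
      skewPiEquiv F E c N J hc hfix ⁻¹' Set.pi Set.univ fun w : {w : InfinitePlace E // IsComplex w} =>
        Metric.closedBall (0 : ↥(skewC N (J.map w.1.embedding))) (windowRadiusC N (J.map w.1.embedding)) :=
    Set.preimage_mono (Set.pi_mono fun w _ => Metric.ball_subset_closedBall)
  rw [← Measure.restrict_apply_self, archTopFormHaar_restrict_image_of_isOpen J hnd hVo hV0 hK hKs hVK,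
    cayleyChartMeasure_apply J _ _ ((isOpen_image_cayleyChart J (hVK.trans hKs) hVo).measurableSet),
    Set.inter_eq_right.2 (Set.subset_preimage_image _ _)]

omit [MeasurableSpace ↥(arch F E c N J)] [BorelSpace ↥(arch F E c N J)] [MeasurableSpace (GL (Fin N) ℂ)] [BorelSpace (GL (Fin N) ℂ)] in
/-- **Fubini for the chart measure of the product set**: `∫_V w₀ dλ = Π_w ∫_{W_w} w₀,w dλ_w`, given (E1) `hlam` and (E2) `hweight`.
[cite: Helgason2000, Ch. I §1 Thm. 1.14 p. 96] [cite: Rogawski1990, §1.7 p. 6] -/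
theorem lintegral_cayleyWeight_preimage_pi_windowC (hc : c ≠ 1) (hfix : ∀ w : InfinitePlace E, c • w = w)
    (hndw : ∀ w : {w : InfinitePlace E // IsComplex w}, lieGramDetC N (J.map w.1.embedding) ≠ 0)
    (hlam : (lieStdLebesgue F E c N J).map (skewPiEquiv F E c N J hc hfix) =
      Measure.pi fun w : {w : InfinitePlace E // IsComplex w} => lieStdLebesgueC N (J.map w.1.embedding))
    (hweight : ∀ X : archSkew F E c N J,
      cayleyWeight F E c N J X = ∏ w : {w : InfinitePlace E // IsComplex w}, cayleyWeightC N (J.map w.1.embedding) (skewPiEquiv F E c N J hc hfix X w)) :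
    ∫⁻ X in skewPiEquiv F E c N J hc hfix ⁻¹' Set.pi Set.univ (fun w : {w : InfinitePlace E // IsComplex w} => windowC N (J.map w.1.embedding)),
        ENNReal.ofReal (cayleyWeight F E c N J X) ∂lieStdLebesgue F E c N J =
      ∏ w : {w : InfinitePlace E // IsComplex w}, ∫⁻ X in windowC N (J.map w.1.embedding),
        ENNReal.ofReal (cayleyWeightC N (J.map w.1.embedding) X) ∂lieStdLebesgueC N (J.map w.1.embedding) := by
  haveI : ∀ w : {w : InfinitePlace E // IsComplex w}, (lieStdLebesgueC N (J.map w.1.embedding)).IsAddHaarMeasure := fun w =>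
    isAddHaarMeasure_lieStdLebesgueC (hndw w)
  haveI : ∀ w : {w : InfinitePlace E // IsComplex w}, SigmaFinite (lieStdLebesgueC N (J.map w.1.embedding)) := fun w => by infer_instance
  haveI : BorelSpace (∀ w : {w : InfinitePlace E // IsComplex w}, ↥(skewC N (J.map w.1.embedding))) := Pi.borelSpace
  -- an opaque measurable equivalence with the same underlying map (keeps `whnf` cheap)
  obtain ⟨eM, heMc⟩ : ∃ eM : ↥(archSkew F E c N J) ≃ᵐ (∀ w : {w : InfinitePlace E // IsComplex w}, ↥(skewC N (J.map w.1.embedding))),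
      ⇑eM = ⇑(skewPiEquiv F E c N J hc hfix) :=
    ⟨(skewPiEquiv F E c N J hc hfix).toHomeomorph.toMeasurableEquiv, by
      rw [Homeomorph.toMeasurableEquiv_coe, ContinuousLinearEquiv.coe_toHomeomorph]⟩
  have heMs : ∀ Y, skewPiEquiv F E c N J hc hfix (eM.symm Y) = Y := fun Y => by
    have h := eM.apply_symm_apply Y
    rwa [heMc] at h
  have hlam' : lieStdLebesgue F E c N J =
      (Measure.pi fun w : {w : InfinitePlace E // IsComplex w} => lieStdLebesgueC N (J.map w.1.embedding)).map eM.symm := by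
    rw [← hlam, ← heMc, MeasurableEquiv.map_symm_map]
  have hpre : eM.symm ⁻¹' (skewPiEquiv F E c N J hc hfix ⁻¹' Set.pi Set.univ
      (fun w : {w : InfinitePlace E // IsComplex w} => windowC N (J.map w.1.embedding))) =
      Set.pi Set.univ fun w : {w : InfinitePlace E // IsComplex w} => windowC N (J.map w.1.embedding) := by
    ext Y
    rw [Set.mem_preimage, Set.mem_preimage, heMs]
  rw [hlam', MeasurableEquiv.restrict_map, lintegral_map_equiv, hpre, Measure.restrict_pi_pi]
  refine (lintegral_congr fun Y => ?_).trans
    (lintegral_pi_prod_ofReal (f := fun (w : {w : InfinitePlace E // IsComplex w}) (X : ↥(skewC N (J.map w.1.embedding))) =>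
        cayleyWeightC N (J.map w.1.embedding) X) _ (fun w => integrableOn_cayleyWeightC_windowC w _) fun w X => cayleyWeightC_nonneg X)
  rw [hweight, ENNReal.ofReal_prod_of_nonneg fun w _ => cayleyWeightC_nonneg _]
  exact Finset.prod_congr rfl fun w _ => by rw [heMs]

/-- **THE PRODUCT THEOREM, `_of` form**: `(archPiEquiv)_* μ^TF = ⊗_w μ^TF_w`, given (E1) `hlam` «`skewPiEquiv` carries `λ` to `⊗_w λ_w`» and (E2) `hweight` «`w₀ = Π_w w₀,w`».
Both sides are Haar measures on `Π_w U(σ_w J)(ℂ)`, hence proportional; they agree on the product of the one-place Cayley windows (★ (P0) on the product window +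
Fubini). [cite: Rogawski1990, §1.7 p. 6] [cite: Helgason2000, Ch. I §1 Thm. 1.14 p. 96] -/
theorem map_archPiEquiv_archTopFormHaar_of (hc : c ≠ 1) (hfix : ∀ w : InfinitePlace E, c • w = w) (hnd : lieGramDet F E c N J ≠ 0)
    (hndw : ∀ w : {w : InfinitePlace E // IsComplex w}, lieGramDetC N (J.map w.1.embedding) ≠ 0)
    (hlam : (lieStdLebesgue F E c N J).map (skewPiEquiv F E c N J hc hfix) =
      Measure.pi fun w : {w : InfinitePlace E // IsComplex w} => lieStdLebesgueC N (J.map w.1.embedding))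
    (hweight : ∀ X : archSkew F E c N J,
      cayleyWeight F E c N J X = ∏ w : {w : InfinitePlace E // IsComplex w}, cayleyWeightC N (J.map w.1.embedding) (skewPiEquiv F E c N J hc hfix X w)) :
    (archTopFormHaar F E c N J).map (archPiEquiv F E c N J hc hfix) =
      Measure.pi fun w : {w : InfinitePlace E // IsComplex w} => (localTopFormHaar N (J.map w.1.embedding) : Measure (archLocal E N J w)) := by
  -- instances (in both spellings `archLocal E N J w` ∕ `unitaryGroupOfForm (starRingEnd ℂ) (J.map σ_w)`, which agree by `rfl`)
  haveI : ∀ w : {w : InfinitePlace E // IsComplex w}, LocallyCompactSpace ↥(unitaryGroupOfForm (starRingEnd ℂ) (J.map w.1.embedding)) := fun w =>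
    locallyCompactSpace_unitaryGroupOfForm_complex (n := Fin N) (J.map w.1.embedding)
  haveI : ∀ w : {w : InfinitePlace E // IsComplex w}, SecondCountableTopology ↥(unitaryGroupOfForm (starRingEnd ℂ) (J.map w.1.embedding)) := fun w =>
    secondCountableTopology_unitaryGroupOfForm_complex (n := Fin N) (J.map w.1.embedding)
  haveI : ∀ w : {w : InfinitePlace E // IsComplex w}, LocallyCompactSpace (archLocal E N J w) := fun w =>
    locallyCompactSpace_unitaryGroupOfForm_complex (n := Fin N) (J.map w.1.embedding)
  haveI : ∀ w : {w : InfinitePlace E // IsComplex w}, SecondCountableTopology (archLocal E N J w) := fun w =>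
    secondCountableTopology_unitaryGroupOfForm_complex (n := Fin N) (J.map w.1.embedding)
  haveI : ∀ w : {w : InfinitePlace E // IsComplex w}, (localTopFormHaar N (J.map w.1.embedding)).IsHaarMeasure := fun w =>
    isHaarMeasure_localTopFormHaar (hndw w)
  haveI := isHaarMeasure_archTopFormHaar J hnd
  haveI : BorelSpace (∀ w : {w : InfinitePlace E // IsComplex w}, ↥(unitaryGroupOfForm (starRingEnd ℂ) (J.map w.1.embedding))) := Pi.borelSpace
  haveI : BorelSpace (∀ w : {w : InfinitePlace E // IsComplex w}, archLocal E N J w) := Pi.borelSpace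
  haveI : ((archTopFormHaar F E c N J).map (archPiEquiv F E c N J hc hfix)).IsHaarMeasure :=
    (archPiEquiv F E c N J hc hfix).isHaarMeasure_map (archTopFormHaar F E c N J)
  have hem : Measurable (archPiEquiv F E c N J hc hfix) := (archPiEquiv F E c N J hc hfix).continuous.measurable
  -- Haar uniqueness on the product group
  have hprop := isMulLeftInvariant_eq_smul ((archTopFormHaar F E c N J).map (archPiEquiv F E c N J hc hfix))
    (Measure.pi fun w : {w : InfinitePlace E // IsComplex w} => (localTopFormHaar N (J.map w.1.embedding) : Measure (archLocal E N J w)))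
  -- the pinning set `S = Π_w ĉ_w(W_w)`
  have hSo : IsOpen (Set.pi Set.univ fun w : {w : InfinitePlace E // IsComplex w} =>
      ((cayleyChartC N (J.map w.1.embedding) '' windowC N (J.map w.1.embedding) : Set (archLocal E N J w)))) :=
    isOpen_set_pi Set.finite_univ fun w _ => isOpen_image_windowC
  have hμS : ((archTopFormHaar F E c N J).map (archPiEquiv F E c N J hc hfix))
      (Set.pi Set.univ fun w => ((cayleyChartC N (J.map w.1.embedding) '' windowC N (J.map w.1.embedding) : Set (archLocal E N J w)))) =
      (Measure.pi fun w : {w : InfinitePlace E // IsComplex w} => (localTopFormHaar N (J.map w.1.embedding) : Measure (archLocal E N J w)))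
        (Set.pi Set.univ fun w => ((cayleyChartC N (J.map w.1.embedding) '' windowC N (J.map w.1.embedding) : Set (archLocal E N J w)))) := by
    rw [Measure.map_apply hem hSo.measurableSet, archPiEquiv_preimage_pi_image_cayleyChartC hc hfix _ fun w => windowC_subset_cayleySourceC]
    exact (archTopFormHaar_image_preimage_pi_windowC hc hfix hnd).trans
      ((lintegral_cayleyWeight_preimage_pi_windowC hc hfix hndw hlam hweight).trans (pi_localTopFormHaar_pi_image_windowC (J := J) hndw).symm)
  -- the scalar is `1`
  have hne := pi_localTopFormHaar_pi_image_windowC_ne (J := J) hndw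
  have hc1 : haarScalarFactor ((archTopFormHaar F E c N J).map (archPiEquiv F E c N J hc hfix))
      (Measure.pi fun w : {w : InfinitePlace E // IsComplex w} => (localTopFormHaar N (J.map w.1.embedding) : Measure (archLocal E N J w))) = 1 := by
    have h := hμS
    rw [hprop, Measure.coe_nnreal_smul_apply] at h
    have h1 : ((haarScalarFactor ((archTopFormHaar F E c N J).map (archPiEquiv F E c N J hc hfix))
        (Measure.pi fun w : {w : InfinitePlace E // IsComplex w} => (localTopFormHaar N (J.map w.1.embedding) : Measure (archLocal E N J w))) : ℝ≥0) :
          ℝ≥0∞) = 1 := by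
      rw [← ENNReal.mul_left_inj hne.1 hne.2, one_mul]
      exact h
    exact_mod_cast h1
  rw [hprop, hc1, one_smul]

end ProductMeasure

end UnitaryArchTopForm

end Literature.NumberTheory.Weil1964

end
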